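import Mathlib.Data.Nat.Log
import Mathlib.Analysis.SpecialFunctions.Log.Base
import Mathlib.Analysis.SpecialFunctions.Pow.Real

/-!
# K1loc, line `Spectral` / thin start — helper: THE BLOCK BUDGET I (dyadic blocks, far-tail block count, uniform block constants)

Helper file of the prover lane on the crux `K1LocalisedCascade` (stmt-AnomalousDissipation-19491), route `SawtoothPulseCascade`
(glue seat; the NUMERIC LAYER of the concrete ledger assembly).  The concrete class steps
`K1Window.tsum_ratioClass_{v,h}step_blocks_le` (`…RatioBlocks`) and `K1Window.tsum_strip_vstep_blocks_le` /
`tsum_lowFibre_hstep_blocks_le` (`…StripBlocks`) leave PER-BLOCK SCALAR hypotheses (`uQ₂^m < Λ_m(uG − v)`, `8τ_m ≤ A_m d₀^m`,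
`Mδ_j < πN_j d₀^m`, `A_m·(…) ≤ ε₀^m`, …) and the output `(√(Σ_{m<M} J_m²) + √feed)² + ((1+γ)^{2j}/Λ_M)²`,
`J_m = r_m (ε₀^m + A_m √(2N_j·4d₀^m))`, `r_m = (Q₁^m+Q₂^m)/(Q₂^m−Q₁^m)`.  This file (part I; part II = `…BlockBudgetSums`)
discharges / bounds them UNIFORMLY for DYADIC blocks `Λ_m = Λ₀·2^m`:
* §1 dyadic blocks (`monotone_dyadicBlocks`, casts);
* §2 the FAR-TAIL BLOCK COUNT: with the canonical `M_b := Nat.clog 2 ⌈x/(Λ₀√f)⌉₊` one has `(x/Λ_{M_b})² ≤ f`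
  (`far_sq_le_of_clog`) and `2^{M_b} ≤ 2x/(Λ₀√f) + 2` (`two_pow_clog_le`), hence `M_b ≤ 1 + log₂(x/(Λ₀√f) + 1)`
  (`natCast_clog_le`, affine in the phase by `one_add_logb_le_affine`) — the number of blocks is logarithmic, so the
  `δ`-linear part of the block sum stays `O(j·δ_j)`;
* §3 UNIFORM BLOCK CONSTANTS: under `Q₂^m ≤ q·Λ_m` with `uq < uG − v` the ratio window has
  `A_m ≤ ((v+uG)+uq)/((uG−v)−uq)` (`ratioBlock_A_le`) and `τ_m ≤ (uπ/(((uG−v)−uq)Λ₀))/2^m` (`ratioBlock_tau_le`), and the ℕ side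
  condition `uQ₂^m < Λ_m(uG−v)` holds (`ratioBlock_hΛQ`); under `K + Q₂^m ≤ q·Λ_mG` with `q < 1` the strip window has
  `A_m ≤ (1+q)/(1−q)`, `τ_m ≤ (π/((1−q)Λ₀G))/2^m`, `K + Q₂^m < Λ_mG` (`stripBlock_*`); `r_m ≤ 1 + 2/ζ` when `ζQ₁ ≤ Q₂ − Q₁`
  (`cutoffRatio_le`).
Pure real/natural-number arithmetic; no definitions; no statement about the crux. [cite: Grafakos2014, Prop. 3.2.7 (3)] [problem: turb]
-/

-- `Summit.<Summit>.<Problem>`: single-conjunct summit, the duplicate namespace segment is deliberate.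
set_option linter.dupNamespace false

noncomputable section

namespace Summit.AnomalousDissipation.AnomalousDissipation.Theorems.SawtoothPulseCascade.K1Window

/-! ## §1 Dyadic blocks `Λ_m = Λ₀·2^m` -/

/-- **Dyadic block edges are monotone**: `m ↦ Λ₀·2^m` is monotone (the `hΛb` hypothesis of the block steps). [folklore] -/
theorem monotone_dyadicBlocks (Λ₀ : ℕ) : Monotone fun m : ℕ => Λ₀ * 2 ^ m :=
  fun _ _ h => Nat.mul_le_mul_left _ (Nat.pow_le_pow_right (by norm_num) h)

/-- The lowest dyadic edge is `Λ₀` (so `1 ≤ Λ₀` gives the `hΛ0` hypothesis of the block steps). [folklore] -/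
theorem dyadicBlocks_zero (Λ₀ : ℕ) : Λ₀ * 2 ^ 0 = Λ₀ := by simp

/-- Consecutive dyadic edges differ by the factor `2`. [folklore] -/
theorem dyadicBlocks_succ (Λ₀ m : ℕ) : Λ₀ * 2 ^ (m + 1) = 2 * (Λ₀ * 2 ^ m) := by ring

/-- Cast of a dyadic edge to `ℝ`. [folklore] -/
theorem cast_dyadicBlocks (Λ₀ m : ℕ) : ((Λ₀ * 2 ^ m : ℕ) : ℝ) = (Λ₀ : ℝ) * 2 ^ m := by push_cast; ring

/-- A dyadic edge is at least `2^m` (`Λ₀ ≥ 1`). [folklore] -/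
theorem two_pow_le_cast_dyadicBlocks {Λ₀ : ℕ} (hΛ₀ : 1 ≤ Λ₀) (m : ℕ) : (2 : ℝ) ^ m ≤ ((Λ₀ * 2 ^ m : ℕ) : ℝ) := by
  rw [cast_dyadicBlocks]
  have h1 : (1 : ℝ) ≤ Λ₀ := by exact_mod_cast hΛ₀
  nlinarith [pow_pos (show (0 : ℝ) < 2 by norm_num) m]

/-! ## §2 The far-tail block count -/

/-- **Far tail below `f` once the last edge is beyond `x/√f`**: `0 ≤ x`, `0 < f`, `x/√f ≤ L` give `(x/L)² ≤ f`. [folklore] -/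
theorem div_sq_le_of_div_sqrt_le {x f L : ℝ} (hx : 0 ≤ x) (hf : 0 < f) (h : x / Real.sqrt f ≤ L) : (x / L) ^ 2 ≤ f := by
  have hsf : 0 < Real.sqrt f := Real.sqrt_pos.mpr hf
  rcases eq_or_lt_of_le hx with rfl | hx'
  · simp [hf.le]
  · have hL : 0 < L := lt_of_lt_of_le (div_pos hx' hsf) h
    have h1 : x / L ≤ Real.sqrt f := by
      rw [div_le_iff₀ hL]
      calc x = x / Real.sqrt f * Real.sqrt f := by field_simp
        _ ≤ L * Real.sqrt f := mul_le_mul_of_nonneg_right h hsf.le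
        _ = Real.sqrt f * L := mul_comm _ _
    have h0 : 0 ≤ x / L := div_nonneg hx hL.le
    calc (x / L) ^ 2 ≤ Real.sqrt f ^ 2 := pow_le_pow_left₀ h0 h1 2
      _ = f := Real.sq_sqrt hf.le

/-- **The canonical block count reaches the far tail**: with `M_b := Nat.clog 2 ⌈x/(Λ₀√f)⌉₊` (`Λ₀ ≥ 1`, `x ≥ 0`, `f > 0`) the last
dyadic edge `Λ_{M_b} = Λ₀·2^{M_b}` satisfies `x/√f ≤ Λ_{M_b}` (for `f ≤ 0` both sides degenerate benignly). [folklore] -/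
theorem div_sqrt_le_dyadicBlocks_clog {x f : ℝ} {Λ₀ : ℕ} (hΛ₀ : 1 ≤ Λ₀) :
    x / Real.sqrt f ≤ ((Λ₀ * 2 ^ Nat.clog 2 ⌈x / (Λ₀ * Real.sqrt f)⌉₊ : ℕ) : ℝ) := by
  have hΛr : (0 : ℝ) < Λ₀ := by exact_mod_cast hΛ₀
  set n : ℕ := ⌈x / (Λ₀ * Real.sqrt f)⌉₊ with hn
  have h1 : x / (Λ₀ * Real.sqrt f) ≤ n := Nat.le_ceil _
  have h2 : (n : ℝ) ≤ ((2 ^ Nat.clog 2 n : ℕ) : ℝ) := by exact_mod_cast Nat.le_pow_clog one_lt_two n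
  have h3 : x / Real.sqrt f = Λ₀ * (x / (Λ₀ * Real.sqrt f)) := by
    field_simp
  rw [h3, Nat.cast_mul]
  exact mul_le_mul_of_nonneg_left (h1.trans h2) hΛr.le

/-- **FAR TAIL OF THE CANONICAL BLOCK COUNT**: `(x/Λ_{M_b})² ≤ f` for `M_b := Nat.clog 2 ⌈x/(Λ₀√f)⌉₊`, `Λ_m = Λ₀·2^m`
(`Λ₀ ≥ 1`, `x ≥ 0`, `f > 0`) — discharges the far term `((1+γ)^{2j}/Λ_M)²` of the block steps at any prescribed level `f`.
[folklore] -/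
theorem far_sq_le_of_clog {x f : ℝ} {Λ₀ : ℕ} (hΛ₀ : 1 ≤ Λ₀) (hx : 0 ≤ x) (hf : 0 < f) :
    (x / ((Λ₀ * 2 ^ Nat.clog 2 ⌈x / (Λ₀ * Real.sqrt f)⌉₊ : ℕ) : ℝ)) ^ 2 ≤ f :=
  div_sq_le_of_div_sqrt_le hx hf (div_sqrt_le_dyadicBlocks_clog hΛ₀)

/-- **The canonical block count is logarithmic**: `2^{M_b} ≤ 2·x/(Λ₀√f) + 2` for `M_b := Nat.clog 2 ⌈x/(Λ₀√f)⌉₊`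
(`Λ₀ ≥ 1`, `x ≥ 0`). [folklore] -/
theorem two_pow_clog_le {x f : ℝ} {Λ₀ : ℕ} (hΛ₀ : 1 ≤ Λ₀) (hx : 0 ≤ x) :
    (2 : ℝ) ^ Nat.clog 2 ⌈x / (Λ₀ * Real.sqrt f)⌉₊ ≤ 2 * (x / (Λ₀ * Real.sqrt f)) + 2 := by
  have hΛr : (0 : ℝ) < Λ₀ := by exact_mod_cast hΛ₀
  have hy : 0 ≤ x / (Λ₀ * Real.sqrt f) := div_nonneg hx (mul_nonneg hΛr.le (Real.sqrt_nonneg _))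
  set n : ℕ := ⌈x / (Λ₀ * Real.sqrt f)⌉₊ with hn
  have hn1 : (n : ℝ) < x / (Λ₀ * Real.sqrt f) + 1 := Nat.ceil_lt_add_one hy
  rcases Nat.lt_or_ge 1 n with h | h
  · -- `n ≥ 2`: `2^(M_b - 1) < n`
    have hc := Nat.pow_pred_clog_lt_self one_lt_two h
    have hpos : 0 < Nat.clog 2 n := Nat.clog_pos one_lt_two h
    have e : Nat.clog 2 n = (Nat.clog 2 n).pred + 1 := (Nat.succ_pred_eq_of_pos hpos).symm
    have h2 : (2 : ℝ) ^ Nat.clog 2 n = 2 * (2 : ℝ) ^ (Nat.clog 2 n).pred := by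
      rw [e, pow_succ, Nat.pred_succ]; ring
    have h3 : ((2 ^ (Nat.clog 2 n).pred : ℕ) : ℝ) < n := by exact_mod_cast hc
    push_cast at h3
    rw [h2]
    linarith
  · -- `n ≤ 1`: `M_b = 0`
    have h0 : Nat.clog 2 n = 0 := Nat.clog_of_right_le_one h 2
    rw [h0, pow_zero]
    linarith

/-- From `2^M ≤ y` (`y > 0`) to `M ≤ log₂ y`. [folklore] -/
theorem natCast_le_logb_of_two_pow_le {M : ℕ} {y : ℝ} (hy : 0 < y) (h : (2 : ℝ) ^ M ≤ y) : (M : ℝ) ≤ Real.logb 2 y := by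
  rw [Real.le_logb_iff_rpow_le one_lt_two hy, Real.rpow_natCast]
  exact h

/-- **Logarithmic block count, `log₂` form**: `M_b ≤ 1 + log₂(x/(Λ₀√f) + 1)` for `M_b := Nat.clog 2 ⌈x/(Λ₀√f)⌉₊`. [folklore] -/
theorem natCast_clog_le {x f : ℝ} {Λ₀ : ℕ} (hΛ₀ : 1 ≤ Λ₀) (hx : 0 ≤ x) :
    ((Nat.clog 2 ⌈x / (Λ₀ * Real.sqrt f)⌉₊ : ℕ) : ℝ) ≤ 1 + Real.logb 2 (x / (Λ₀ * Real.sqrt f) + 1) := by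
  have hΛr : (0 : ℝ) < Λ₀ := by exact_mod_cast hΛ₀
  have hy : 0 ≤ x / (Λ₀ * Real.sqrt f) := div_nonneg hx (mul_nonneg hΛr.le (Real.sqrt_nonneg _))
  have h2 := two_pow_clog_le (f := f) hΛ₀ hx
  have hpos : 0 < 2 * (x / (Λ₀ * Real.sqrt f)) + 2 := by linarith
  have h3 := natCast_le_logb_of_two_pow_le hpos h2
  have e : 2 * (x / (Λ₀ * Real.sqrt f)) + 2 = 2 * (x / (Λ₀ * Real.sqrt f) + 1) := by ring
  rw [e, Real.logb_mul (by norm_num) (by linarith), Real.logb_self_eq_one one_lt_two] at h3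
  exact h3

/-- **The block count is affine in the phase**: if `y ≤ C·ρ^j` with `C ≥ 1`, `ρ ≥ 1`, then
`1 + log₂(y + 1) ≤ 2 + log₂ C + j·log₂ ρ` (used with `y = (1+γ)^{2j}/(Λ₀√f_j)`). [folklore] -/
theorem one_add_logb_le_affine {y C ρ : ℝ} {j : ℕ} (hy : 0 ≤ y) (hC : 1 ≤ C) (hρ : 1 ≤ ρ) (h : y ≤ C * ρ ^ j) :
    1 + Real.logb 2 (y + 1) ≤ 2 + Real.logb 2 C + j * Real.logb 2 ρ := by
  have hρj : 1 ≤ ρ ^ j := one_le_pow₀ hρ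
  have hCρ : 1 ≤ C * ρ ^ j := by nlinarith
  have h1 : y + 1 ≤ 2 * (C * ρ ^ j) := by linarith
  have h2 : Real.logb 2 (y + 1) ≤ Real.logb 2 (2 * (C * ρ ^ j)) :=
    Real.logb_le_logb_of_le one_lt_two (by linarith) h1
  have h3 : Real.logb 2 (2 * (C * ρ ^ j)) = 1 + Real.logb 2 C + j * Real.logb 2 ρ := by
    rw [Real.logb_mul (by norm_num) (by positivity), Real.logb_self_eq_one one_lt_two,
      Real.logb_mul (by positivity) (by positivity), Real.logb_pow]
    ring
  linarith

/-! ## §3 Uniform block constants -/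

/-- **Denominator of the ratio-window constants is uniformly positive on dyadic blocks**: `Q₂ ≤ qΛ`, `uq < uG − v`, `1 ≤ Λ` give
`((uG−v) − uq)·Λ ≤ (uG−v)Λ − uQ₂` and the left side is positive. [folklore] -/
theorem ratioBlock_denom_ge {u v G : ℕ} {q : ℝ} {Λ Q₂ : ℕ} (huq : (u : ℝ) * q < (u : ℝ) * G - v)
    (hΛ : 1 ≤ Λ) (hQ : (Q₂ : ℝ) ≤ q * Λ) :
    0 < (((u : ℝ) * G - v) - u * q) * Λ ∧ (((u : ℝ) * G - v) - u * q) * Λ ≤ ((u : ℝ) * G - v) * Λ - u * Q₂ := by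
  have hΛr : (1 : ℝ) ≤ Λ := by exact_mod_cast hΛ
  have hu0 : (0 : ℝ) ≤ u := Nat.cast_nonneg _
  refine ⟨mul_pos (by linarith) (by linarith), ?_⟩
  nlinarith [mul_le_mul_of_nonneg_left hQ hu0]

/-- **The ℕ side condition `uQ₂ < Λ(uG − v)` of the ratio block steps** from the real block geometry `Q₂ ≤ qΛ`, `uq < uG − v`,
`Λ ≥ 1` (`v < uG`). [folklore] -/
theorem ratioBlock_hΛQ {u v G : ℕ} {q : ℝ} {Λ Q₂ : ℕ} (hvu : v < u * G) (huq : (u : ℝ) * q < (u : ℝ) * G - v)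
    (hΛ : 1 ≤ Λ) (hQ : (Q₂ : ℝ) ≤ q * Λ) : u * Q₂ < Λ * (u * G - v) := by
  have h := ratioBlock_denom_ge huq hΛ hQ
  have h1 : (u : ℝ) * Q₂ < ((u : ℝ) * G - v) * Λ := by linarith [h.1, h.2]
  have h2 : ((u * Q₂ : ℕ) : ℝ) < ((Λ * (u * G - v) : ℕ) : ℝ) := by
    rw [Nat.cast_mul, Nat.cast_mul, Nat.cast_sub hvu.le, Nat.cast_mul]; linarith
  exact_mod_cast h2

/-- **Uniform RATIO constant of the ratio window on a block**: `Q₂ ≤ qΛ`, `uq < uG − v`, `Λ ≥ 1` give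
`A(Λ, Q₂) = ((v+uG)Λ + uQ₂)/((uG−v)Λ − uQ₂) ≤ ((v+uG) + uq)/((uG−v) − uq)` (independent of the block). [folklore] -/
theorem ratioBlock_A_le {u v G : ℕ} {q : ℝ} {Λ Q₂ : ℕ} (hq : 0 ≤ q) (huq : (u : ℝ) * q < (u : ℝ) * G - v)
    (hΛ : 1 ≤ Λ) (hQ : (Q₂ : ℝ) ≤ q * Λ) :
    (((v : ℝ) + u * G) * Λ + u * Q₂) / (((u : ℝ) * G - v) * Λ - u * Q₂) ≤
      (((v : ℝ) + u * G) + u * q) / (((u : ℝ) * G - v) - u * q) := by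
  have h := ratioBlock_denom_ge huq hΛ hQ
  have hΛr : (1 : ℝ) ≤ Λ := by exact_mod_cast hΛ
  have hu0 : (0 : ℝ) ≤ u := Nat.cast_nonneg _
  have hv0 : (0 : ℝ) ≤ v := Nat.cast_nonneg _
  have hG0 : (0 : ℝ) ≤ G := Nat.cast_nonneg _
  have hQ0 : (0 : ℝ) ≤ Q₂ := Nat.cast_nonneg _
  have hc : 0 < ((u : ℝ) * G - v) - u * q := by linarith
  have hD : 0 < ((u : ℝ) * G - v) * Λ - u * Q₂ := lt_of_lt_of_le h.1 h.2
  rw [div_le_div_iff₀ hD hc]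
  have hQ' : (u : ℝ) * Q₂ ≤ u * q * Λ := by nlinarith [mul_le_mul_of_nonneg_left hQ hu0]
  have hnum : ((v : ℝ) + u * G) * Λ + u * Q₂ ≤ (((v : ℝ) + u * G) + u * q) * Λ := by nlinarith
  have hk0 : 0 ≤ ((v : ℝ) + u * G) + u * q := by positivity
  calc (((v : ℝ) + u * G) * Λ + u * Q₂) * (((u : ℝ) * G - v) - u * q)
      ≤ (((v : ℝ) + u * G) + u * q) * Λ * (((u : ℝ) * G - v) - u * q) :=
        mul_le_mul_of_nonneg_right hnum hc.le
    _ = (((v : ℝ) + u * G) + u * q) * ((((u : ℝ) * G - v) - u * q) * Λ) := by ring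
    _ ≤ (((v : ℝ) + u * G) + u * q) * (((u : ℝ) * G - v) * Λ - u * Q₂) :=
        mul_le_mul_of_nonneg_left h.2 hk0

/-- **Uniform LAYER constant of the ratio window on a dyadic block**: `Q₂ ≤ qΛ₀2^m`, `uq < uG − v`, `Λ₀ ≥ 1` give
`τ(Λ₀2^m, Q₂) = uπ/((uG−v)Λ₀2^m − uQ₂) ≤ (uπ/(((uG−v) − uq)Λ₀))/2^m`. [folklore] -/
theorem ratioBlock_tau_le {u v G : ℕ} {q : ℝ} {Λ₀ Q₂ : ℕ} (m : ℕ) (huq : (u : ℝ) * q < (u : ℝ) * G - v)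
    (hΛ₀ : 1 ≤ Λ₀) (hQ : (Q₂ : ℝ) ≤ q * ((Λ₀ * 2 ^ m : ℕ) : ℝ)) :
    (u : ℝ) * Real.pi / (((u : ℝ) * G - v) * ((Λ₀ * 2 ^ m : ℕ) : ℝ) - u * Q₂) ≤
      (u : ℝ) * Real.pi / ((((u : ℝ) * G - v) - u * q) * Λ₀) / 2 ^ m := by
  have hΛ : 1 ≤ Λ₀ * 2 ^ m := le_trans hΛ₀ (Nat.le_mul_of_pos_right _ (by positivity))
  have h := ratioBlock_denom_ge huq hΛ hQ
  have hnum : 0 ≤ (u : ℝ) * Real.pi := by positivity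
  rw [div_div]
  calc (u : ℝ) * Real.pi / (((u : ℝ) * G - v) * ((Λ₀ * 2 ^ m : ℕ) : ℝ) - u * Q₂)
      ≤ (u : ℝ) * Real.pi / ((((u : ℝ) * G - v) - u * q) * ((Λ₀ * 2 ^ m : ℕ) : ℝ)) :=
        div_le_div_of_nonneg_left hnum h.1 h.2
    _ = (u : ℝ) * Real.pi / ((((u : ℝ) * G - v) - u * q) * Λ₀ * 2 ^ m) := by rw [cast_dyadicBlocks]; ring

/-- **The ℕ side condition `K + Q₂ < ΛG` of the strip block steps** from `K + Q₂ ≤ q·ΛG` with `q < 1` and `1 ≤ ΛG`. [folklore] -/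
theorem stripBlock_hΛQ {K G Λ Q₂ : ℕ} {q : ℝ} (hq1 : q < 1) (hΛG : 1 ≤ Λ * G)
    (hQ : ((K + Q₂ : ℕ) : ℝ) ≤ q * ((Λ * G : ℕ) : ℝ)) : K + Q₂ < Λ * G := by
  have h1 : (1 : ℝ) ≤ ((Λ * G : ℕ) : ℝ) := by exact_mod_cast hΛG
  have h2 : ((K + Q₂ : ℕ) : ℝ) < ((Λ * G : ℕ) : ℝ) := by nlinarith
  exact_mod_cast h2

/-- **Uniform RATIO constant of the strip window on a block**: `K + Q₂ ≤ q·ΛG`, `q < 1`, `1 ≤ ΛG` give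
`A = (K+Q₂+ΛG)/(ΛG−K−Q₂) ≤ (1+q)/(1−q)`. [folklore] -/
theorem stripBlock_A_le {K G Λ Q₂ : ℕ} {q : ℝ} (hq1 : q < 1) (hΛG : 1 ≤ Λ * G)
    (hQ : ((K + Q₂ : ℕ) : ℝ) ≤ q * ((Λ * G : ℕ) : ℝ)) :
    (((K + Q₂ : ℕ) : ℝ) + ((Λ * G : ℕ) : ℝ)) / (((Λ * G : ℕ) : ℝ) - ((K + Q₂ : ℕ) : ℝ)) ≤ (1 + q) / (1 - q) := by
  set L : ℝ := ((Λ * G : ℕ) : ℝ) with hL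
  set p : ℝ := ((K + Q₂ : ℕ) : ℝ) with hp
  have h1 : (1 : ℝ) ≤ L := by rw [hL]; exact_mod_cast hΛG
  have hp0 : 0 ≤ p := Nat.cast_nonneg _
  have hD : 0 < L - p := by nlinarith
  rw [div_le_div_iff₀ hD (by linarith)]
  nlinarith

/-- **Uniform LAYER constant of the strip window on a dyadic block**: `K + Q₂ ≤ q·Λ₀2^mG`, `q < 1`, `1 ≤ Λ₀`, `1 ≤ G` give
`τ = π/(Λ₀2^mG − K − Q₂) ≤ (π/((1−q)Λ₀G))/2^m`. [folklore] -/
theorem stripBlock_tau_le {K G Λ₀ Q₂ : ℕ} {q : ℝ} (m : ℕ) (hq1 : q < 1) (hΛ₀ : 1 ≤ Λ₀) (hG : 1 ≤ G)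
    (hQ : ((K + Q₂ : ℕ) : ℝ) ≤ q * ((Λ₀ * 2 ^ m * G : ℕ) : ℝ)) :
    Real.pi / (((Λ₀ * 2 ^ m * G : ℕ) : ℝ) - ((K + Q₂ : ℕ) : ℝ)) ≤ Real.pi / ((1 - q) * Λ₀ * G) / 2 ^ m := by
  set L : ℝ := ((Λ₀ * 2 ^ m * G : ℕ) : ℝ) with hL
  set p : ℝ := ((K + Q₂ : ℕ) : ℝ) with hp
  have hL' : L = (Λ₀ : ℝ) * 2 ^ m * G := by rw [hL]; push_cast; ring
  have hΛ0r : (1 : ℝ) ≤ Λ₀ := by exact_mod_cast hΛ₀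
  have hGr : (1 : ℝ) ≤ G := by exact_mod_cast hG
  have h2m : (1 : ℝ) ≤ 2 ^ m := one_le_pow₀ (by norm_num)
  have hLpos : 0 < L := by rw [hL']; positivity
  have hp0 : 0 ≤ p := Nat.cast_nonneg _
  have hD1 : 0 < (1 - q) * L := mul_pos (by linarith) hLpos
  have hD : (1 - q) * L ≤ L - p := by nlinarith
  rw [div_div]
  calc Real.pi / (L - p) ≤ Real.pi / ((1 - q) * L) := div_le_div_of_nonneg_left Real.pi_pos.le hD1 hD
    _ = Real.pi / ((1 - q) * Λ₀ * G * 2 ^ m) := by rw [hL']; ring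

/-- **Uniform cut-off RATIO**: `0 ≤ Q₁`, `ζ > 0`, `Q₁ < Q₂`, `ζQ₁ ≤ Q₂ − Q₁` give `(Q₁+Q₂)/(Q₂−Q₁) ≤ 1 + 2/ζ`. [folklore] -/
theorem cutoffRatio_le {Q₁ Q₂ ζ : ℝ} (hζ : 0 < ζ) (hlt : Q₁ < Q₂) (h : ζ * Q₁ ≤ Q₂ - Q₁) :
    (Q₁ + Q₂) / (Q₂ - Q₁) ≤ 1 + 2 / ζ := by
  have hD : 0 < Q₂ - Q₁ := by linarith
  rw [div_le_iff₀ hD]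
  have e : (1 + 2 / ζ) * (Q₂ - Q₁) = (Q₂ - Q₁) + 2 * ((Q₂ - Q₁) / ζ) := by ring
  rw [e]
  have h1 : Q₁ ≤ (Q₂ - Q₁) / ζ := by rw [le_div_iff₀ hζ]; linarith
  linarith

/-- The cut-off ratio is at least `1` (`0 ≤ Q₁ < Q₂`). [folklore] -/
theorem one_le_cutoffRatio {Q₁ Q₂ : ℝ} (hQ₁ : 0 ≤ Q₁) (hlt : Q₁ < Q₂) : 1 ≤ (Q₁ + Q₂) / (Q₂ - Q₁) := by
  rw [le_div_iff₀ (by linarith)]; linarith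

end Summit.AnomalousDissipation.AnomalousDissipation.Theorems.SawtoothPulseCascade.K1Window
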